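import Summits.ResolutionOfSingularities.ResolutionOfSingularities.Theorems.EquisingularLiftEquisingularLiftNatSubchainSupplierInvDefs
import Literature.AlgebraicGeometry.Resolution.PointBlowupAlgebraCharts
import HarnessLib

/-!
# [OURS · L1 W4.5(b) · EL♮(3)] T-PKG-TRANSPORT-ALG: `TCPlus.ConeDeltaRegular` is transported along ring isomorphisms of the base
# (crux `EquisingularLiftNatThree` stmt-ResolutionOfSingularities-20148 / parent 20038; rung v7 TC⁺, `CentredPackage` transport)

NOT a statement of any manuscript. Helper file of the chain res-L1-w45b (cell `res-hironaka`, LADDER-RESOLUTION rung L, slot W4.5(b));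
OURS; AI-written, weaker than expert review; `--supports stmt-ResolutionOfSingularities-20148 --as helper` by res-L1-w45b-stub-2 (object
(6) T-PKG-TRANSPORT-ALG of res-L1-w45b-stub-1's K8/INV BOARD RULING 2026-08-27T13:44:20Z, signature verbatim). No `sorry`; standard axioms.
It closes nothing by itself.

WHAT. `TCPlus.ConeDeltaRegular c Φ` (res-L1-w45b-stub-1, …NatSubchainSupplierInvDefs p532383) is a statement about the triple `(A, c, Φ)`
alone (charts `A[c/c_j]` of the blow-up of `(c)`, their primes over `𝔪_A` through `e₀ = c₀/c_j` and `Φ(e′)`, and ALL models of the local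
rings); res-L1-w45b-stub-1's T-PKG-TRANSPORT-SCHEME moves a `CentredPackage` along a stalk isomorphism `𝒪_{X,p} ≅ 𝒪_{X₂,p₂}` (a blow-up
that is an isomorphism near `p`) and needs the algebraic half:

* **`TCPlus.coneDeltaRegular_map_ringEquiv (e : A ≃+* A₂) (c) (Φ) : ConeDeltaRegular c Φ → ConeDeltaRegular (fun i => e (c i)) (map e Φ)`.**

Route: the chart map `ε_j : A[c/c_j] → A₂[e c/e c_j]` along `e` (Literature `blowupAlgebraMap`, bijective for an isomorphism:
`blowupAlgebra.blowupAlgebraMap_bijective_of_ringEquiv`, PointBlowupAlgebraCharts) sends `c_l/c_j ↦ e c_l/e c_j` and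
`Φ(e′) ↦ (eΦ)(e′)`; a prime `𝔔₂` of the `A₂`-chart pulls back to the prime `𝔔 = ε_j⁻¹ 𝔔₂` over `𝔪_A` (`e` is local); a model `S`
of `(A₂-chart)_{𝔔₂}` IS a model of `(A-chart)_𝔔` for the structure map through `ε_j` (`isLocalization_atPrime_comap_ringEquiv`), and the
two in-carrier centre ideals of `S` coincide — so both clauses (regularity, codimension `2`) transfer literally.

* `TCPlus.isLocalization_atPrime_comap_ringEquiv` (generic) — models are insensitive to a ring isomorphism of the base;
* `TCPlus.map_span_range_ringEquiv`, `blowupAlgebraMap_ringEquiv_bijective`, `blowupAlgebraMap_ringEquiv_frac`,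
  `blowupAlgebraMap_ringEquiv_aeval` — the chart isomorphism and what it does to the fractions and to `Φ(e′)`;
* `TCPlus.coneDeltaRegular_map_toRingHom` — the theorem spelled with `e.toRingHom` (definitionally the verbatim one).

References: The Stacks Project, Tag 0804; U. Görtz, T. Wedhorn, *Algebraic Geometry I* (2020), (13.19), Prop. 13.96 (2)
[cite: GortzWedhorn2020]. Tree inputs: p532383 (defs), Literature BlowupStrictTransform / BlowupAlgebraStrictTransform (`blowupAlgebraMap`,
`blowupAlgebraMap_gen`, `blowupAlgebraMap_comp_algebraMap`), PointBlowupAlgebraCharts (`blowupAlgebraMap_bijective_of_ringEquiv`).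
-/

set_option linter.dupNamespace false -- mandated namespace `Summit.<Summit>.<Problem>` of this single-conjunct summit

noncomputable section

namespace Summit.ResolutionOfSingularities.ResolutionOfSingularities.Cruxes.EquisingularLiftNat.Sections.TCPlus

open MvPolynomial IsLocalRing Literature.AlgebraicGeometry.Resolution

universe u

/-! ## Generic: models are insensitive to a ring isomorphism of the base -/

/-- **A model of `(B₂)_{𝔔₂}` is a model of `B_{ε⁻¹𝔔₂}` along a ring isomorphism `ε : B ≅ B₂`**, for the structure map
`B → B₂ → S`. [folklore] -/
theorem isLocalization_atPrime_comap_ringEquiv {B B₂ S : Type*} [CommRing B] [CommRing B₂] [CommRing S] (ε : B ≃+* B₂)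
    [Algebra B₂ S] (𝔔₂ : Ideal B₂) [𝔔₂.IsPrime] [IsLocalization.AtPrime S 𝔔₂] :
    @IsLocalization.AtPrime B _ S _ ((algebraMap B₂ S).comp ε.toRingHom).toAlgebra (𝔔₂.comap ε.toRingHom) _ := by
  letI : Algebra B S := ((algebraMap B₂ S).comp ε.toRingHom).toAlgebra
  have halg : ∀ b, algebraMap B S b = algebraMap B₂ S (ε b) := fun _ => rfl
  rw [IsLocalization.AtPrime, isLocalization_iff]
  refine ⟨?_, ?_, ?_⟩
  · rintro ⟨y, hy⟩
    rw [halg]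
    exact IsLocalization.map_units S (⟨ε y, hy⟩ : 𝔔₂.primeCompl)
  · intro z
    obtain ⟨⟨x, s⟩, hxs⟩ := IsLocalization.surj 𝔔₂.primeCompl z
    have hs : ε.symm (s : B₂) ∈ (𝔔₂.comap ε.toRingHom).primeCompl := by
      intro hmem
      exact s.2 (by simpa [Ideal.mem_comap] using hmem)
    refine ⟨⟨ε.symm x, ⟨ε.symm s, hs⟩⟩, ?_⟩
    simp only [halg, RingEquiv.apply_symm_apply]
    exact hxs
  · intro x y hxy
    rw [halg, halg] at hxy
    obtain ⟨m, hm⟩ := IsLocalization.exists_of_eq (M := 𝔔₂.primeCompl) hxy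
    have hm' : ε.symm (m : B₂) ∈ (𝔔₂.comap ε.toRingHom).primeCompl := by
      intro hmem
      exact m.2 (by simpa [Ideal.mem_comap] using hmem)
    refine ⟨⟨ε.symm m, hm'⟩, ε.injective ?_⟩
    simp only [map_mul, RingEquiv.apply_symm_apply]
    exact hm

/-! ## The chart isomorphism along `e : A ≅ A₂` -/

section Chart

variable {A A₂ : Type u} [CommRing A] [CommRing A₂] (e : A ≃+* A₂) {r : ℕ} (c : Fin r → A) (j : Fin r)

/-- `e(c) A₂ = (e ∘ c)`. [folklore] -/
theorem map_span_range_ringEquiv :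
    (Ideal.span (Set.range c)).map e.toRingHom = Ideal.span (Set.range fun i => e.toRingHom (c i)) := by
  rw [Ideal.map_span, ← Set.range_comp]
  rfl

/-- The chart map `ε_j : A[c/c_j] → A₂[e c/e c_j]` along the isomorphism `e` is bijective. [folklore] -/
theorem blowupAlgebraMap_ringEquiv_bijective :
    Function.Bijective (blowupAlgebraMap e.toRingHom (Ideal.span (Set.range c))
      (Ideal.span (Set.range fun i => e.toRingHom (c i))) (c j) (map_span_range_ringEquiv e c).le) := by
  have key : ∀ (J : Ideal A₂) (hJ : (Ideal.span (Set.range c)).map e.toRingHom = J),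
      Function.Bijective (blowupAlgebraMap e.toRingHom (Ideal.span (Set.range c)) J (c j) hJ.le) := by
    rintro J rfl
    exact blowupAlgebra.blowupAlgebraMap_bijective_of_ringEquiv e _ _
  exact key _ (map_span_range_ringEquiv e c)

/-- `ε_j (c_l/c_j) = e c_l / e c_j`. [folklore] -/
theorem blowupAlgebraMap_ringEquiv_frac (l : Fin r) :
    blowupAlgebraMap e.toRingHom (Ideal.span (Set.range c)) (Ideal.span (Set.range fun i => e.toRingHom (c i))) (c j)
        (map_span_range_ringEquiv e c).le (blowupAlgebra.frac c j l) =
      blowupAlgebra.frac (fun i => e.toRingHom (c i)) j l :=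
  blowupAlgebraMap_gen _ _ _ _ _ (c l) _

/-- `ε_j (Φ(g)) = (eΦ)(ε_j g)`: the chart map on a polynomial expression in chart elements. [folklore] -/
theorem blowupAlgebraMap_ringEquiv_aeval {σ : Type*} (Φ : MvPolynomial σ A)
    (g : σ → blowupAlgebra (Ideal.span (Set.range c)) (c j)) :
    blowupAlgebraMap e.toRingHom (Ideal.span (Set.range c)) (Ideal.span (Set.range fun i => e.toRingHom (c i))) (c j)
        (map_span_range_ringEquiv e c).le (MvPolynomial.aeval g Φ) =
      MvPolynomial.aeval (fun l => blowupAlgebraMap e.toRingHom (Ideal.span (Set.range c))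
        (Ideal.span (Set.range fun i => e.toRingHom (c i))) (c j) (map_span_range_ringEquiv e c).le (g l))
        (MvPolynomial.map e.toRingHom Φ) := by
  rw [MvPolynomial.aeval_def, MvPolynomial.aeval_def, MvPolynomial.eval₂_map, MvPolynomial.eval₂_comp_left,
    blowupAlgebraMap_comp_algebraMap]
  rfl

end Chart

/-! ## The transport theorem -/

/-- Transport of `ConeDeltaRegular` along `e`, spelled with `e.toRingHom` (the chart types then agree on the nose). [folklore] -/
theorem coneDeltaRegular_map_toRingHom {A A₂ : Type u} [CommRing A] [IsLocalRing A] [CommRing A₂] [IsLocalRing A₂]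
    (e : A ≃+* A₂) {r : ℕ} (c : Fin (r + 1) → A) (Φ : MvPolynomial (Fin r) A) (h : TCPlus.ConeDeltaRegular c Φ) :
    TCPlus.ConeDeltaRegular (fun i => e.toRingHom (c i)) (MvPolynomial.map e.toRingHom Φ) := by
  intro j' 𝔔₂ _ h𝔔₂ he₀₂ hΦ₂ S _ _ _
  -- the chart isomorphism `ε : A[c/c_j] ≅ A₂[e c/e c_j]`, `j = j′+1`, abstracted
  obtain ⟨ε, hεbij, hεcomp, hεfrac, hεaeval⟩ :
      ∃ ε : blowupAlgebra (Ideal.span (Set.range c)) (c j'.succ) →+*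
          blowupAlgebra (Ideal.span (Set.range fun i => e.toRingHom (c i))) ((fun i => e.toRingHom (c i)) j'.succ),
        Function.Bijective ε ∧ ε.comp (algebraMap A _) = (algebraMap A₂ _).comp e.toRingHom ∧
        (∀ l, ε (blowupAlgebra.frac c j'.succ l) = blowupAlgebra.frac (fun i => e.toRingHom (c i)) j'.succ l) ∧
        ε (MvPolynomial.aeval (fun l : Fin r => blowupAlgebra.frac c j'.succ l.succ) Φ) =
          MvPolynomial.aeval (fun l : Fin r => blowupAlgebra.frac (fun i => e.toRingHom (c i)) j'.succ l.succ)
            (MvPolynomial.map e.toRingHom Φ) := by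
    refine ⟨_, blowupAlgebraMap_ringEquiv_bijective e c j'.succ, blowupAlgebraMap_comp_algebraMap _ _ _ _ _,
      blowupAlgebraMap_ringEquiv_frac e c j'.succ, ?_⟩
    rw [blowupAlgebraMap_ringEquiv_aeval]
    simp only [blowupAlgebraMap_ringEquiv_frac]
  let εe : blowupAlgebra (Ideal.span (Set.range c)) (c j'.succ) ≃+*
      blowupAlgebra (Ideal.span (Set.range fun i => e.toRingHom (c i))) ((fun i => e.toRingHom (c i)) j'.succ) :=
    RingEquiv.ofBijective ε hεbij
  have hεe : εe.toRingHom = ε := rfl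
  -- `S` as a model of the `A`-chart at `𝔔 = ε⁻¹ 𝔔₂`
  letI : Algebra (blowupAlgebra (Ideal.span (Set.range c)) (c j'.succ)) S := ((algebraMap _ S).comp εe.toRingHom).toAlgebra
  haveI := isLocalization_atPrime_comap_ringEquiv εe 𝔔₂ (S := S)
  have halg : ∀ b, algebraMap (blowupAlgebra (Ideal.span (Set.range c)) (c j'.succ)) S b = algebraMap _ S (ε b) := fun _ => rfl
  -- the hypotheses pull back (`e` is local)
  haveI := IsLocalHom.of_surjective e.toRingHom e.surjective
  have h1 : (𝔔₂.comap εe.toRingHom).comap (algebraMap A _) = maximalIdeal A := by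
    rw [hεe, Ideal.comap_comap, hεcomp, ← Ideal.comap_comap, h𝔔₂, IsLocalRing.maximalIdeal_comap]
  have h2 : blowupAlgebra.frac c j'.succ 0 ∈ 𝔔₂.comap εe.toRingHom := by
    rw [Ideal.mem_comap, hεe, hεfrac]
    exact he₀₂
  have h3 : MvPolynomial.aeval (fun l : Fin r => blowupAlgebra.frac c j'.succ l.succ) Φ ∈ 𝔔₂.comap εe.toRingHom := by
    rw [Ideal.mem_comap, hεe, hεaeval]
    exact hΦ₂
  have key := h j' (𝔔₂.comap εe.toRingHom) h1 h2 h3 S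
  rw [halg, halg, hεfrac, hεaeval] at key
  exact key

/-- **T-PKG-TRANSPORT-ALG: `ConeDeltaRegular` is transported along a ring isomorphism of the base** (signature verbatim from
res-L1-w45b-stub-1's K8/INV BOARD RULING 2026-08-27T13:44:20Z (4)). [cite: GortzWedhorn2020, (13.19) p. 414]
[OURS · L1 W4.5b]; NOT a statement of the manuscript. -/
theorem coneDeltaRegular_map_ringEquiv {A A₂ : Type u} [CommRing A] [IsLocalRing A] [CommRing A₂] [IsLocalRing A₂]
    (e : A ≃+* A₂) {r : ℕ} (c : Fin (r + 1) → A) (Φ : MvPolynomial (Fin r) A) :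
    TCPlus.ConeDeltaRegular c Φ → TCPlus.ConeDeltaRegular (fun i => e (c i)) (MvPolynomial.map (e : A →+* A₂) Φ) :=
  coneDeltaRegular_map_toRingHom e c Φ

end Summit.ResolutionOfSingularities.ResolutionOfSingularities.Cruxes.EquisingularLiftNat.Sections.TCPlus
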